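import Mathlib
import Summits.RiemannHypothesis.RiemannHypothesis.Theorems.WeilGroundStateGroundStateSimpleEvenArchOddLowerB
import Summits.RiemannHypothesis.RiemannHypothesis.Theorems.WeilGroundStateGroundStateSimpleEvenArchEvenUpper
import Summits.RiemannHypothesis.RiemannHypothesis.Theorems.WeilGroundStateGroundStateSimpleEvenArchAtoms
import Summits.RiemannHypothesis.RiemannHypothesis.Theorems.WeilGroundStateGroundStateSimpleEvenCellThird
import Summits.RiemannHypothesis.RiemannHypothesis.Theorems.WeilGroundStateGroundStateSimpleEvenCellTransfer
import HarnessLib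

/-!
# Crux `GroundStateSimpleEven` (stmt-RiemannHypothesis-1526), line `parity-multiplicity-commutator` v3:
# THE CRUX ON EVERY ARCHIMEDEAN WINDOW — `stub_archimedeanWindows`

Support file (`--supports stmt-RiemannHypothesis-1526`) of the lead's stub `stub_archimedeanWindows`
(the crux on every archimedean window `0 < a ≤ (log 2)/2`, by the Fourier bathtub for the odd
sector against the parabola's Rayleigh quotient).
`∀ a, 0 < a → a ≤ (log 2)/2 → WeilWindowSimpleEven a`: on `(0, 7/25]` pointwise from `U(a) < L(a)` (the even upper bound `stub_archEvenUpper` against the odd lower bounds `stub_archOddLower`, `weilWindowSimpleEven_on_cell_of_le` with `b = c = a`), and on `[7/25, (log 2)/2]` by the cell transfer with the kernel-checked odd bound `1/20` at `(log 2)/2` (`re_weilQuadratic_ge_of_odd_log_two_half`) and `U(7/25) < 1/20`.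
Everything is GENERIC in the cap `E : ℝ → ℝ`: its values on the 27 pieces (the Taylor polynomial
`2u²/3 − 2u⁴/15 + 4u⁶/315` on `(0, 7/5]`, certified constants on 24 panels with 7-smooth rational
ends up to `16/5`, `1` on `(16/5, 47/10]`, `2` beyond, `1` at `u ≤ 0`) and its measurability are
SECTION HYPOTHESES, included where used; the cap itself is constructed once, in
`…ArchCapExists.lean`.  Generated mechanically from the certified table of the lead's folder
(`work/numerics/final_design.py`, `gen2.py`); every constant is re-checked by the kernel.
-/

noncomputable section

open Set MeasureTheory Filter
open Literature.NumberTheory.LFunctions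
open scoped Real Topology

namespace Summit.RiemannHypothesis.RiemannHypothesis.Theorems.GroundStateSimpleEven


set_option linter.dupNamespace false in
/-- The window clause on `(0, 1/5]`, pointwise: `ε(a) ≤ −log a + V(1/5) < −log a + L ≤` odd sector. [folklore] -/
theorem arch_window_0 {a : ℝ} (ha : 0 < a) (ha0 : a ≤ (1 / 5)) :
    WeilWindowSimpleEven a := by
  obtain ⟨hO, -, -, -⟩ := Summit.RiemannHypothesis.RiemannHypothesis.Theorems.stub_archOddLower
  have hE := Summit.RiemannHypothesis.RiemannHypothesis.Theorems.stub_archEvenUpper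
  have hl2a := Real.log_two_gt_d9
  have hl2b := Real.log_two_lt_d9
  have hπ := GroundStateSimpleEven.arch_pi_lt
  have hapos : 0 < a := ha
  have hal : a ≤ Real.log 2 / 2 := by linarith
  have hU := hE a hapos hal
  have hb2 : a ^ 2 ≤ (1 / 5) ^ 2 := pow_le_pow_left₀ hapos.le ha0 2
  have hb3 : a ^ 3 ≤ (1 / 5) ^ 3 := pow_le_pow_left₀ hapos.le ha0 3
  have hb5 : a ^ 5 ≤ (1 / 5) ^ 5 := pow_le_pow_left₀ hapos.le ha0 5
  refine GroundStateSimpleEven.weilWindowSimpleEven_on_cell_of_le (b := a) (c := a)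
    (U := -Real.log a + (Real.pi / 2 + Real.log 2 + 15 / 16 * (248 / 225) - 5.3716) + (35 / 12 * (1 / 5) + (1 / 5) ^ 2 / 12 + 11 / 30 * (1 / 5) ^ 3 + 3 / 1000 * (1 / 5) ^ 5))
    (L := -Real.log a + ((-(122379 / 100000)))) hapos ?_ ?_ ?_ le_rfl le_rfl
  · norm_num
    linarith
  · linarith
  · intro g hg hs hn hodd
    exact hO a ha ha0 g hg hs hodd hn

set_option linter.dupNamespace false in
/-- The window clause on `(1/5, 1/4]`, pointwise: `ε(a) ≤ −log a + V(1/4) < −log a + L ≤` odd sector. [folklore] -/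
theorem arch_window_1 {a : ℝ} (ha : (1 / 5) ≤ a) (ha0 : a ≤ (1 / 4)) :
    WeilWindowSimpleEven a := by
  obtain ⟨-, hO, -, -⟩ := Summit.RiemannHypothesis.RiemannHypothesis.Theorems.stub_archOddLower
  have hE := Summit.RiemannHypothesis.RiemannHypothesis.Theorems.stub_archEvenUpper
  have hl2a := Real.log_two_gt_d9
  have hl2b := Real.log_two_lt_d9
  have hπ := GroundStateSimpleEven.arch_pi_lt
  have hapos : 0 < a := lt_of_lt_of_le (by norm_num) ha
  have hal : a ≤ Real.log 2 / 2 := by linarith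
  have hU := hE a hapos hal
  have hb2 : a ^ 2 ≤ (1 / 4) ^ 2 := pow_le_pow_left₀ hapos.le ha0 2
  have hb3 : a ^ 3 ≤ (1 / 4) ^ 3 := pow_le_pow_left₀ hapos.le ha0 3
  have hb5 : a ^ 5 ≤ (1 / 4) ^ 5 := pow_le_pow_left₀ hapos.le ha0 5
  refine GroundStateSimpleEven.weilWindowSimpleEven_on_cell_of_le (b := a) (c := a)
    (U := -Real.log a + (Real.pi / 2 + Real.log 2 + 15 / 16 * (248 / 225) - 5.3716) + (35 / 12 * (1 / 4) + (1 / 4) ^ 2 / 12 + 11 / 30 * (1 / 4) ^ 3 + 3 / 1000 * (1 / 4) ^ 5))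
    (L := -Real.log a + ((-(29627 / 25000)))) hapos ?_ ?_ ?_ le_rfl le_rfl
  · norm_num
    linarith
  · linarith
  · intro g hg hs hn hodd
    exact hO a ha ha0 g hg hs hodd hn

set_option linter.dupNamespace false in
/-- The window clause on `(1/4, 27/100]`, pointwise: `ε(a) ≤ −log a + V(27/100) < −log a + L ≤` odd sector. [folklore] -/
theorem arch_window_2 {a : ℝ} (ha : (1 / 4) ≤ a) (ha0 : a ≤ (27 / 100)) :
    WeilWindowSimpleEven a := by
  obtain ⟨-, -, hO, -⟩ := Summit.RiemannHypothesis.RiemannHypothesis.Theorems.stub_archOddLower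
  have hE := Summit.RiemannHypothesis.RiemannHypothesis.Theorems.stub_archEvenUpper
  have hl2a := Real.log_two_gt_d9
  have hl2b := Real.log_two_lt_d9
  have hπ := GroundStateSimpleEven.arch_pi_lt
  have hapos : 0 < a := lt_of_lt_of_le (by norm_num) ha
  have hal : a ≤ Real.log 2 / 2 := by linarith
  have hU := hE a hapos hal
  have hb2 : a ^ 2 ≤ (27 / 100) ^ 2 := pow_le_pow_left₀ hapos.le ha0 2
  have hb3 : a ^ 3 ≤ (27 / 100) ^ 3 := pow_le_pow_left₀ hapos.le ha0 3
  have hb5 : a ^ 5 ≤ (27 / 100) ^ 5 := pow_le_pow_left₀ hapos.le ha0 5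
  refine GroundStateSimpleEven.weilWindowSimpleEven_on_cell_of_le (b := a) (c := a)
    (U := -Real.log a + (Real.pi / 2 + Real.log 2 + 15 / 16 * (248 / 225) - 5.3716) + (35 / 12 * (27 / 100) + (27 / 100) ^ 2 / 12 + 11 / 30 * (27 / 100) ^ 3 + 3 / 1000 * (27 / 100) ^ 5))
    (L := -Real.log a + ((-(7317 / 6250)))) hapos ?_ ?_ ?_ le_rfl le_rfl
  · norm_num
    linarith
  · linarith
  · intro g hg hs hn hodd
    exact hO a ha ha0 g hg hs hodd hn

set_option linter.dupNamespace false in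
/-- The window clause on `(27/100, 7/25]`, pointwise: `ε(a) ≤ −log a + V(7/25) < −log a + L ≤` odd sector. [folklore] -/
theorem arch_window_3 {a : ℝ} (ha : (27 / 100) ≤ a) (ha0 : a ≤ (7 / 25)) :
    WeilWindowSimpleEven a := by
  obtain ⟨-, -, -, hO⟩ := Summit.RiemannHypothesis.RiemannHypothesis.Theorems.stub_archOddLower
  have hE := Summit.RiemannHypothesis.RiemannHypothesis.Theorems.stub_archEvenUpper
  have hl2a := Real.log_two_gt_d9
  have hl2b := Real.log_two_lt_d9
  have hπ := GroundStateSimpleEven.arch_pi_lt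
  have hapos : 0 < a := lt_of_lt_of_le (by norm_num) ha
  have hal : a ≤ Real.log 2 / 2 := by linarith
  have hU := hE a hapos hal
  have hb2 : a ^ 2 ≤ (7 / 25) ^ 2 := pow_le_pow_left₀ hapos.le ha0 2
  have hb3 : a ^ 3 ≤ (7 / 25) ^ 3 := pow_le_pow_left₀ hapos.le ha0 3
  have hb5 : a ^ 5 ≤ (7 / 25) ^ 5 := pow_le_pow_left₀ hapos.le ha0 5
  refine GroundStateSimpleEven.weilWindowSimpleEven_on_cell_of_le (b := a) (c := a)
    (U := -Real.log a + (Real.pi / 2 + Real.log 2 + 15 / 16 * (248 / 225) - 5.3716) + (35 / 12 * (7 / 25) + (7 / 25) ^ 2 / 12 + 11 / 30 * (7 / 25) ^ 3 + 3 / 1000 * (7 / 25) ^ 5))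
    (L := -Real.log a + ((-(58349 / 50000)))) hapos ?_ ?_ ?_ le_rfl le_rfl
  · norm_num
    linarith
  · linarith
  · intro g hg hs hn hodd
    exact hO a ha ha0 g hg hs hodd hn

set_option linter.dupNamespace false in
/-- The top cell `[7/25, (log 2)/2]`: `ε(7/25) ≤ U < 1/20 ≤` odd sector at `(log 2)/2`. [folklore] -/
theorem arch_window_top {a : ℝ} (ha : 7 / 25 ≤ a) (ha0 : a ≤ Real.log 2 / 2) :
    WeilWindowSimpleEven a := by
  have hE := Summit.RiemannHypothesis.RiemannHypothesis.Theorems.stub_archEvenUpper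
  have hl2a := Real.log_two_gt_d9
  have hl2b := Real.log_two_lt_d9
  obtain ⟨-, -, hl5a, hl5b, hl7a, hl7b, -⟩ := Summit.RiemannHypothesis.RiemannHypothesis.Theorems.stub_logAtoms
  have hπ := GroundStateSimpleEven.arch_pi_lt
  have hU := hE (7 / 25) (by norm_num) (by linarith)
  have hlog : Real.log (7 / 25 : ℝ) = Real.log 7 - 2 * Real.log 5 := by
    rw [Real.log_div (by norm_num) (by norm_num), GroundStateSimpleEven.arch_log_25]
  refine GroundStateSimpleEven.weilWindowSimpleEven_on_cell_of_le (b := 7 / 25) (c := Real.log 2 / 2)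
    (U := -Real.log (7 / 25) + (Real.pi / 2 + Real.log 2 + 15 / 16 * (248 / 225) - 5.3716) + (35 / 12 * (7 / 25) + (7 / 25) ^ 2 / 12 + 11 / 30 * (7 / 25) ^ 3 + 3 / 1000 * (7 / 25) ^ 5)) (L := 1 / 20) (by norm_num) ?_ hU ?_ ha ha0
  · rw [hlog]
    norm_num
    linarith
  · intro g hg hs hn hodd
    exact GroundStateSimpleEven.re_weilQuadratic_ge_of_odd_log_two_half hg hs hn hodd


end Summit.RiemannHypothesis.RiemannHypothesis.Theorems.GroundStateSimpleEven

namespace Summit.RiemannHypothesis.RiemannHypothesis.Theorems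

set_option linter.dupNamespace false in
/-- **STUB (ARCH) — the crux `GroundStateSimpleEven` on every archimedean window** (lead c2, line
`parity-multiplicity-commutator` v3): for every `0 < a ≤ (log 2)/2` the bottom of Weil's form on
`[-a, a]` is simple, isolated and even (`WeilWindowSimpleEven a`).  RH-free.  On `(0, 7/25]` the
parabola's Rayleigh quotient `−log a + V(a)` (Markov form, closed-form tail of the jump density)
stays below the Fourier-bathtub lower bound `−log a + L` of the odd sector (certified cap, Euler–
Maclaurin minorant of `Re ψ(1/4+it/2)`, certified evaluation); on `[7/25, (log 2)/2]` the cell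
transfer closes with the kernel-checked odd bound `1/20` at `(log 2)/2`.  This extends the proved
windows of the crux from `(0, 1/100] ∪ [1/3, (log 2)/2]` (Suzuki 2026 Thm 1.4; p137081) to the whole
archimedean range `(0, (log 2)/2]`. [folklore] -/
theorem stub_archimedeanWindows :
    ∀ a : ℝ, 0 < a → a ≤ Real.log 2 / 2 → WeilWindowSimpleEven a := by
  intro a ha hal
  by_cases h1 : a ≤ 1 / 5
  · exact GroundStateSimpleEven.arch_window_0 ha h1
  by_cases h2 : a ≤ 1 / 4
  · exact GroundStateSimpleEven.arch_window_1 (le_of_not_ge h1) h2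
  by_cases h3 : a ≤ 27 / 100
  · exact GroundStateSimpleEven.arch_window_2 (le_of_not_ge h2) h3
  by_cases h4 : a ≤ 7 / 25
  · exact GroundStateSimpleEven.arch_window_3 (le_of_not_ge h3) h4
  exact GroundStateSimpleEven.arch_window_top (le_of_not_ge h4) hal

end Summit.RiemannHypothesis.RiemannHypothesis.Theorems
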